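import Summits.RiemannHypothesis.RiemannHypothesis.Theorems.PfPersistenceF5Comb
import HarnessLib

/-!
# PF persistence, fake seat 5 — THEOREM F5-PAIR-SWAP: a two-site re-weighting is caught at ℓ¹ depth

Unit `pub-rhpf-fake-5` (gen 5) of the `pub-rhpf` cell — mechanism / rigidity campaign; **no RH claims**.
(FAKES.md §5.8 ADDENDUM 2; GAP-CLASSES rows F5-SWAP-G / F5-G.)

THEOREM F5-COMB (`PfPersistenceF5Comb.comb_negative_or_zeta_not_positive'`) is stated for an
arbitrary comb that is STRAY-FREE on the perturbed sites, with the signed lag counts `ν(log n)` left to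
the user.  This file makes it turnkey for the family named in the seat's brief — PRIME-PAIR SWAPS and, more
generally, ANY re-weighting supported on two sites `n₀ < n₁` (`w' = w_ζ` off `{n₀, n₁}`,
`cᵢ = w'(nᵢ) − w_ζ(nᵢ)` of arbitrary signs and sizes):

* `teeth`, `signs` — an explicit four-tooth comb: one designated pair of teeth at mutual distance
  `log n₀` at the left end of `[-H, H]`, one at distance `log n₁` at the right end,
  `H = ½ log n₀ + log n₁ + b`, signs `(1, sgn c₀, 1, sgn c₁)`;
* `teeth_strayFree` — for a profile half-width `b` with `2b ≤ log n₀` and `2b ≤ log(n₁/n₀)` every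
  non-designated difference of teeth stays `2b` away from `log n₀` and `log n₁`;
* `lagCount_teeth_fst/snd` — the signed lag counts are `ν(log n₀) = sgn c₀`, `ν(log n₁) = sgn c₁`, so
  `Σ cₙ ν(log n) = |c₀| + |c₁|`;
* `pairSwap_negative_or_zeta_not_positive` — **THEOREM F5-PAIR-SWAP**: if `Re Q_ζ(g₁) ≤ ε‖g₁‖₂²` for a
  real Weil test `g₁ ⊆ [-b, b]`, `g₁ ≠ 0` in `L²`, and `15 ε < |c₀| + |c₁|`, then EITHER `ζ`'s explicit-formula
  functional is not Weil-positive on `[-a, a]`, `a = ½ log n₀ + log n₁ + 2b`, OR the four-tooth comb is a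
  test function with `Re Q_{w'} < 0` there.  The depth is the `ℓ¹` mass `|c₀| + |c₁|`: a swap
  (`c₀ = −c₁`), which every aggregate prime-sum reader misses, is caught exactly as deep as an unsigned
  perturbation of the same mass.  (The window `a` is far outside the served range for `{7, 8}`
  (`a ≈ 3.05 + 2b`); that the `ℓ¹` depth is already harvested at `a ≤ 1.96` is DATA, `certs/f5-swap/`.)

All statements are RH-free and weight-free.  References: A. Weil 1952; E. Bombieri, Rend. Mat. Acc.
Lincei (9) 11 (2000) §3–4.
-/

set_option linter.dupNamespace false  -- the mandated namespace repeats `RiemannHypothesis`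

noncomputable section

open scoped ArithmeticFunction ComplexConjugate
open Set MeasureTheory Complex Literature.NumberTheory.LFunctions
open Summit.RiemannHypothesis.RiemannHypothesis.Theorems.PfPersistenceDownCone
open Summit.RiemannHypothesis.RiemannHypothesis.Theorems.PfPersistenceBarrier
open Summit.RiemannHypothesis.RiemannHypothesis.Theorems.PfPersistenceBarrier.ExplicitDatum
open Summit.RiemannHypothesis.RiemannHypothesis.Theorems.PfPersistenceF5CombPSD (comb)
open Summit.RiemannHypothesis.RiemannHypothesis.Theorems.PfPersistenceF5Comb (lagCount
  comb_negative_or_zeta_not_positive')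

namespace Summit.RiemannHypothesis.RiemannHypothesis.Theorems.PfPersistenceF5PairSwap

variable {g₁ : ℝ → ℝ} {b : ℝ}

/-! ## §1 The four-tooth comb -/

/-- Half-span of the teeth: `H = ½ L₀ + L₁ + b` (`Lᵢ = log nᵢ`). -/
def teethHalf (L₀ L₁ b : ℝ) : ℝ := L₀ / 2 + L₁ + b

/-- The four teeth `(-H, -H + L₀, H − L₁, H)`: a pair at distance `L₀` on the left, a pair at distance
`L₁` on the right. -/
def teeth (L₀ L₁ b : ℝ) : Fin 4 → ℝ :=
  ![-teethHalf L₀ L₁ b, -teethHalf L₀ L₁ b + L₀, teethHalf L₀ L₁ b - L₁, teethHalf L₀ L₁ b]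

/-- `sgn c` with `sgn 0 = 1` (any unit value works at `c = 0`). -/
def swapSign (c : ℝ) : ℝ := if 0 ≤ c then 1 else -1

/-- The signs `(1, sgn c₀, 1, sgn c₁)` of the four teeth. -/
def signs (c₀ c₁ : ℝ) : Fin 4 → ℝ := ![1, swapSign c₀, 1, swapSign c₁]

/-- `c · sgn c = |c|`. [folklore] -/
theorem mul_swapSign (c : ℝ) : c * swapSign c = |c| := by
  unfold swapSign
  split_ifs with h
  · rw [mul_one, abs_of_nonneg h]
  · rw [mul_neg_one, abs_of_neg (not_le.mp h)]

/-- `(sgn c)² = 1`. [folklore] -/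
theorem swapSign_sq (c : ℝ) : swapSign c ^ 2 = 1 := by
  unfold swapSign
  split_ifs <;> norm_num

/-- The signs are bounded by one. [folklore] -/
theorem signs_sq_le (c₀ c₁ : ℝ) : ∀ j, (signs c₀ c₁ j) ^ 2 ≤ 1 := by
  intro j
  fin_cases j <;> simp [signs, swapSign_sq]

/-- The half-span is nonnegative. [folklore] -/
theorem teethHalf_nonneg {L₀ L₁ : ℝ} (hL₀ : 0 ≤ L₀) (hL₁ : 0 ≤ L₁) (hb : 0 ≤ b) :
    0 ≤ teethHalf L₀ L₁ b := by
  unfold teethHalf; positivity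

/-- The teeth lie in `[-H, H]`. [folklore] -/
theorem abs_teeth_le {L₀ L₁ : ℝ} (hL₀ : 0 ≤ L₀) (hL₁ : 0 ≤ L₁) (hb : 0 ≤ b) :
    ∀ j, |teeth L₀ L₁ b j| ≤ teethHalf L₀ L₁ b := by
  intro j
  fin_cases j <;> simp only [teeth, teethHalf, Fin.zero_eta, Fin.isValue, Fin.mk_one, Fin.reduceFinMk,
    Matrix.cons_val_zero, Matrix.cons_val_one, Matrix.cons_val, abs_le] <;>
    constructor <;> linarith

/-- **Stray-freeness.** With `2b ≤ L₀` and `2b ≤ L₁ − L₀`, every difference of teeth other than the two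
designated ones stays `2b` away from `L₀` and from `L₁`. [folklore] -/
theorem teeth_strayFree {L₀ L₁ : ℝ} (hb : 0 < b) (h0 : 2 * b ≤ L₀) (h01 : 2 * b ≤ L₁ - L₀) {L : ℝ}
    (hL : L = L₀ ∨ L = L₁) :
    ∀ j l, teeth L₀ L₁ b j - teeth L₀ L₁ b l ≠ L → 2 * b ≤ |L - (teeth L₀ L₁ b j - teeth L₀ L₁ b l)| := by
  intro j l hne
  rcases hL with rfl | rfl <;> fin_cases j <;> fin_cases l <;>
    simp only [teeth, teethHalf, Fin.zero_eta, Fin.isValue, Fin.mk_one, Fin.reduceFinMk,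
      Matrix.cons_val_zero, Matrix.cons_val_one, Matrix.cons_val] at hne ⊢ <;>
    first
      | (apply le_abs.2; left; linarith)
      | (apply le_abs.2; right; linarith)
      | (exfalso; apply hne; ring)

/-- Termwise evaluation of the lag-count summands at lag `L₀`: only the designated pair `(1, 0)`
survives. [folklore] -/
theorem lagTerm_fst {L₀ L₁ : ℝ} (hb : 0 < b) (h0 : 2 * b ≤ L₀) (h01 : 2 * b ≤ L₁ - L₀) (c₀ c₁ : ℝ) :
    ∀ j l : Fin 4, (if teeth L₀ L₁ b j - teeth L₀ L₁ b l = L₀ then signs c₀ c₁ j * signs c₀ c₁ l else 0)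
      = if j = 1 ∧ l = 0 then swapSign c₀ else 0 := by
  intro j l
  fin_cases j <;> fin_cases l <;>
    simp only [teeth, teethHalf, signs, Fin.zero_eta, Fin.isValue, Fin.mk_one, Fin.reduceFinMk,
      Matrix.cons_val_zero, Matrix.cons_val_one, Matrix.cons_val, one_mul, mul_one,
      and_true, and_self, if_true, Fin.reduceEq, and_false, if_false] <;>
    first
      | (apply if_neg; intro h; linarith)
      | (apply if_pos; ring)

/-- Termwise evaluation at lag `L₁`: only the designated pair `(3, 2)` survives. [folklore] -/
theorem lagTerm_snd {L₀ L₁ : ℝ} (hb : 0 < b) (h0 : 2 * b ≤ L₀) (h01 : 2 * b ≤ L₁ - L₀) (c₀ c₁ : ℝ) :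
    ∀ j l : Fin 4, (if teeth L₀ L₁ b j - teeth L₀ L₁ b l = L₁ then signs c₀ c₁ j * signs c₀ c₁ l else 0)
      = if j = 3 ∧ l = 2 then swapSign c₁ else 0 := by
  intro j l
  fin_cases j <;> fin_cases l <;>
    simp only [teeth, teethHalf, signs, Fin.zero_eta, Fin.isValue, Fin.mk_one, Fin.reduceFinMk,
      Matrix.cons_val_zero, Matrix.cons_val_one, Matrix.cons_val, one_mul, mul_one,
      and_true, and_self, if_true, Fin.reduceEq, and_false, if_false] <;>
    first
      | (apply if_neg; intro h; linarith)
      | (apply if_pos; ring)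

/-- **Signed lag count at `log n₀`** is `sgn c₀`. [folklore] -/
theorem lagCount_teeth_fst {L₀ L₁ : ℝ} (hb : 0 < b) (h0 : 2 * b ≤ L₀) (h01 : 2 * b ≤ L₁ - L₀)
    (c₀ c₁ : ℝ) : lagCount 4 (teeth L₀ L₁ b) (signs c₀ c₁) L₀ = swapSign c₀ := by
  unfold lagCount
  simp_rw [lagTerm_fst hb h0 h01 c₀ c₁]
  simp [Fin.sum_univ_four]

/-- **Signed lag count at `log n₁`** is `sgn c₁`. [folklore] -/
theorem lagCount_teeth_snd {L₀ L₁ : ℝ} (hb : 0 < b) (h0 : 2 * b ≤ L₀) (h01 : 2 * b ≤ L₁ - L₀)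
    (c₀ c₁ : ℝ) : lagCount 4 (teeth L₀ L₁ b) (signs c₀ c₁) L₁ = swapSign c₁ := by
  unfold lagCount
  simp_rw [lagTerm_snd hb h0 h01 c₀ c₁]
  simp [Fin.sum_univ_four]

/-! ## §2 THEOREM F5-PAIR-SWAP -/

/-- **THEOREM F5-PAIR-SWAP (two-site re-weightings are caught at ℓ¹ depth).** `w' = w_ζ` off
`{n₀, n₁}`, `cᵢ = w'(nᵢ) − w_ζ(nᵢ)` arbitrary reals (a swap `n₀ ↔ n₁` is `c₀ = −c₁`); `g₁` a real Weil test
supported in `[-b, b]`, `b > 0`, `2b ≤ log n₀`, `2b ≤ log n₁ − log n₀`, not a.e. zero.  If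
`Re Q_ζ(g₁) ≤ ε‖g₁‖₂²` and `15 ε < |c₀| + |c₁|`, then EITHER `ζ`'s explicit-formula functional is not
Weil-positive on `[-a, a]` with `a = ½ log n₀ + log n₁ + 2b`, OR the explicit four-tooth comb
(`teeth`, `signs`) has `Re Q_{w'} < 0`: the fake is negative on that window, at depth the `ℓ¹` mass —
the cancellation `c₀ + c₁ = 0` of a swap buys nothing.  RH-free, weight-free.
[cite: Bombieri2000Weil, §4] -/
theorem pairSwap_negative_or_zeta_not_positive {w' : ℕ → ℝ} {n₀ n₁ : ℕ}
    (hoff : ∀ n ∉ ({n₀, n₁} : Finset ℕ), w' n = zetaTable n) (hb : 0 < b)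
    (h0 : 2 * b ≤ Real.log n₀) (h01 : 2 * b ≤ Real.log n₁ - Real.log n₀)
    (hg : IsWeilTest fun t ↦ (g₁ t : ℂ)) (hs : tsupport (fun t ↦ (g₁ t : ℂ)) ⊆ Icc (-b) b) {ε₀ : ℝ}
    (hq : (weilQuadratic fun t ↦ (g₁ t : ℂ)).re ≤ ε₀ * ∫ t, ‖(g₁ t : ℂ)‖ ^ 2)
    (hpos : 0 < ∫ t, ‖(g₁ t : ℂ)‖ ^ 2)
    (hbig : 15 * ε₀ < |w' n₀ - zetaTable n₀| + |w' n₁ - zetaTable n₁|) :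
    ¬ WeilPositivityOn (Real.log n₀ / 2 + Real.log n₁ + 2 * b) ∨
      ((tableDatum w').quadratic (comb 4 (teeth (Real.log n₀) (Real.log n₁) b)
        (signs (w' n₀ - zetaTable n₀) (w' n₁ - zetaTable n₁)) fun t ↦ (g₁ t : ℂ))).re < 0 := by
  set L₀ := Real.log (n₀ : ℝ) with hL₀
  set L₁ := Real.log (n₁ : ℝ) with hL₁
  have hL₀nn : 0 ≤ L₀ := Real.log_natCast_nonneg n₀
  have hL₁nn : 0 ≤ L₁ := by linarith
  have hn : n₀ ≠ n₁ := by
    rintro rfl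
    have : L₁ - L₀ = 0 := sub_self _
    linarith
  have hwin : Real.log n₀ / 2 + Real.log n₁ + 2 * b = teethHalf L₀ L₁ b + b := by
    simp only [teethHalf, hL₀, hL₁]; ring
  rw [hwin]
  refine comb_negative_or_zeta_not_positive' hb hoff hg hs (teethHalf_nonneg hL₀nn hL₁nn hb.le)
    (teeth L₀ L₁ b) (signs _ _) (abs_teeth_le hL₀nn hL₁nn hb.le) (signs_sq_le _ _) ?_ hq hpos ?_
  · intro n hn' j l hne
    simp only [Finset.mem_insert, Finset.mem_singleton] at hn'
    have hL : Real.log n = L₀ ∨ Real.log n = L₁ := by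
      rcases hn' with rfl | rfl
      · exact Or.inl rfl
      · exact Or.inr rfl
    exact teeth_strayFree hb h0 h01 hL j l hne
  · rw [Finset.sum_pair hn, lagCount_teeth_fst hb h0 h01, lagCount_teeth_snd hb h0 h01, mul_swapSign,
      mul_swapSign]
    norm_num
    exact hbig

end Summit.RiemannHypothesis.RiemannHypothesis.Theorems.PfPersistenceF5PairSwap

end
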